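import Summits.QuantumFields.BalabanUV.Beta.MixedWardPacking
import Summits.QuantumFields.BalabanUV.Beta.BorderLetterPacking

/-!
# `BalabanUV.Beta.BorderWardPacking` — binder row D1, hW side: **THE PACKING ADAPTER FROM A BOND-LEVEL WARD LAW OF an1's SECOND-ORDER BORDER
# TABLE TO THE hW END's TWO EXACT LEVEL-0 BORDER WARD LETTERS (W-B₀)∕(W-B₀″)** at the literal of record (β sub-cell, BINDER-OWNERS row D1 OWNER, an2 gen 21, K-W2)

HONEST FRAMING (cell charter, verbatim): «discharging BetaPertH makes Balaban's UV stability UNCONDITIONAL — a real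
constructive-QFT result; it is NOT the continuum limit and NOT the Clay problem.»
HONEST DEPENDENCY: continuum YM on T⁴ ⇐ BetaPertH ∧ nine spine estimates (0/9 proved); BetaPertH ⇐ (D1) ∧ (D4) ∧ CAP+tail;
G-an2-4 gates asym, D1 and NE2/3/4.
DERIVED cell leaf ([folklore] kernel bookkeeping; no `def`).  No statement of Bałaban's papers, no `[cite:]`, no `Prop` fact is minted.  CONDITIONAL WIRING:
the bond-level border Ward law (WB-bond) is a HYPOTHESIS (exact-ℚ toy evidence ENGINE-W(owner), X-an2-52 — NOT a theorem of the tree); this file repacks it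
into the binders `hBord0`∕`hBord0''` of `RowD1JointEnd.symmetries_JsRowD1_of_letters` at `vh₂S := vh₂SAn1 Lc`.  Discharges NO letter; 0∕4 binders.
NOT D1, NOT `BetaPertH`, NOT continuum, NOT Clay.

WHAT (`d + 1 = 4`, centred root `ρ_c`, `Lc ≥ 1`, any weight `cB`; `s := vh2KerAt ρ_c Lc`, `m := vhKerAt ρ_c Lc`, `T(f;g,h) := ½(s(f;g,h) + s(f;h,g))`):
* §1 entrywise forms of the letter's two sides at `vh₂SAn1` (`wardB_inl_inr` over leaf-05's `BorderLetterPacking.vh₂SAn1_inl_inr`, `datB_inl_inr`; the `(inr, inl)` block is minus the transpose on both sides —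
  `vh₂SAn1_antiTwin`, `vhSAt_symm`; the `(inl,inl)`∕`(inr,inr)` blocks vanish on both sides).
* §2 **`wardBorder_of_bondLaw`**: (WB-bond) — «for every coarse site `Y`, coarse bond `(m, y_b)`, fluctuation bond `f = (β,x)` and background bond `h = (κ′,u′)`:
  `(cB∕Lc⁴)·Σ_{v∈box}Σ_κ [T_{(m,y_b)}(f;(κ,s_v−e_κ),h) − T_{(m,y_b)}(f;(κ,s_v),h)] = cVH·m_{(m,y_b)}(f,h)·(½Σ_v[Lc•y_b + ρ_c = s_v] − ½Σ_v[x = s_v])`,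
  `s_v = Lc•Y + v`, `cVH = −(Lc⁴·½·Lc⁴)`» — gives `hBord0[vh₂S := vh₂SAn1 Lc, r := ctrOff]`; **`wardBorder''_of_bondLaw`**: the same law gives `hBord0''`
  (`vh₂SAn1_swap`).
* §3 **`symmetries_JsRowD1Pin_of_bondLaws`**: hW ∧ hR for `JsRowD1Pin` ⟸ hM ∧ hInv ∧ (WB-bond)[cB := −Lc¹²∕4] ∧ (WM-bond)[cΛ := 2∕Lc⁴] — the hW side of the row now
  reads «two bond-level ℚ-identities about an1's averaging tables», the hR side «hM, hInv».
Provenance: β sub-cell, unit beta-an2 gen 21, 2026-08-20 (v1); no existing file touched.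
-/

open Finset
open scoped BigOperators
open Literature.MathematicalPhysics.QuantumFieldTheory
open Literature.MathematicalPhysics.QuantumFieldTheory.Balaban1983to89
open Literature.MathematicalPhysics.QuantumFieldTheory.Balaban1983to89.Beta
open B6BondElimination (unitVec)
open ExpKernelCalculus (MKer comp)
open KernelWard (divV)
open AffineAveraging (box toSite)
open AveragingContours (blk off)
open AveragingContoursRooted (ctr ctrOff ctrOff_mem_box)
open AveragingHessianKernels (packVH packVH_inl_inr packVH_inr_inl packVH_inl_inl packVH_inr_inr eq_smul_blk_of_off_eq_zero)
open AveragingHessianKernelsRooted (vhSAt vhKerAt hessFFAt hessKerAt linKerAt vhSAt_symm)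
open AveragingMixedJetTables (vh₂SAt vh2KerAt mixFFAt mixKerAt)
open PolarizationSign (reflSign WardTransversal AxisReflectionCovariant)
open KernelReflection (refK)
open ResolventReflection (bref Φ)
open OneStepResolventKernel (Fib)
open OneStepKernelFamily (TbalOf flipK)
open BalabanStepJetsSucc (wVH)
open Summit.QuantumFields.BalabanUV.Beta.TameKernelCalculus
open Summit.QuantumFields.BalabanUV.Beta.BorderedHessian (diagK diagK_apply comp_diagK_left comp_diagK_right stepScale ctGen)
open Summit.QuantumFields.BalabanUV.Beta.AveragingWardRootedStencils (legInd legInd_apply legInd_inl legInd_inr)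
open Summit.QuantumFields.BalabanUV.Beta.WardLocusStencils (divV_apply)
open Summit.QuantumFields.BalabanUV.Beta.SecondOrderBorderGauge (actB)
open Summit.QuantumFields.BalabanUV.Beta.SecondOrderBorderModel (Twall)
open Summit.QuantumFields.BalabanUV.Beta.SecondOrderSocketIdentification (atw vh₂SAn1 vh₂SAn1_inl_inl vh₂SAn1_inr_inr vh₂SAn1_antiTwin vh₂SAn1_swap)
open Summit.QuantumFields.BalabanUV.Beta.RowD1JointEnd (JsRowD1Pin)
open Summit.QuantumFields.BalabanUV.Beta.MixedWardPacking (symmetries_JsRowD1Pin_of_letters_bondWard)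
open Summit.QuantumFields.BalabanUV.Beta.BorderLetterPacking (vh₂SAn1_inl_inr)

namespace Summit.QuantumFields.BalabanUV.Beta.BorderWardPacking

noncomputable section

variable {Lc : ℕ} [NeZero Lc]

/-! ## §1 Entrywise forms of the two sides at `vh₂SAn1` -/

omit [NeZero Lc] in
/-- [folklore] Abbreviation-free name for the letter's LEFT side at `vh₂SAn1` (first slot, weight `cB`, coarse site `Y`, second bond `(κ′,u′)`). -/
theorem wardB_def (cB : ℝ) (Y : Fin (3 + 1) → ℤ) (κ' : Fin (3 + 1)) (u' x z : Fin (3 + 1) → ℤ) (a b : Fib 3) :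
    ((stepScale 3 Lc 0 * (Lc : ℝ) ^ (3 + 1))⁻¹ • ∑ v ∈ box (3 + 1) Lc,
        divV (fun κ u => cB • vh₂SAn1 Lc κ u κ' u') ((Lc : ℤ) • Y + toSite v)) x z a b =
      ((Lc : ℝ) ^ (3 + 1))⁻¹ * ∑ v ∈ box (3 + 1) Lc, ∑ κ : Fin (3 + 1),
        (cB * vh₂SAn1 Lc κ ((Lc : ℤ) • Y + toSite v - unitVec κ) κ' u' x z a b - cB * vh₂SAn1 Lc κ ((Lc : ℤ) • Y + toSite v) κ' u' x z a b) := by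
  have h1 : stepScale 3 Lc 0 = 1 := by simp [BorderedHessian.stepScale]
  simp only [h1, one_mul, Pi.smul_apply, Finset.sum_apply, smul_eq_mul, divV_apply]

omit [NeZero Lc] in
/-- [folklore] **THE LEFT SIDE OF (W-B₀) AT `vh₂SAn1`, `(inl, inr)` ENTRIES**: `Lc⁻⁴·Σ_{v,κ} cB·(T(f;(κ,s_v−e_κ),h) − T(f;(κ,s_v),h))` on the support
`off z = 0` (`b = (m, blk z)`), `0` off it. -/
theorem wardB_inl_inr (cB : ℝ) (Y : Fin (3 + 1) → ℤ) (κ' : Fin (3 + 1)) (u' x z : Fin (3 + 1) → ℤ) (β m : Fin (3 + 1)) :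
    ((stepScale 3 Lc 0 * (Lc : ℝ) ^ (3 + 1))⁻¹ • ∑ v ∈ box (3 + 1) Lc,
        divV (fun κ u => cB • vh₂SAn1 Lc κ u κ' u') ((Lc : ℤ) • Y + toSite v)) x z (Sum.inl β) (Sum.inr m) =
      if off Lc z = 0 then
        ((Lc : ℝ) ^ (3 + 1))⁻¹ * ∑ v ∈ box (3 + 1) Lc, ∑ κ : Fin (3 + 1),
          cB * ((1 / 2 : ℝ) * (vh2KerAt (toSite (ctrOff 4 Lc)) Lc m (blk Lc z) (β, x) (κ, (Lc : ℤ) • Y + toSite v - unitVec κ) (κ', u')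
              + vh2KerAt (toSite (ctrOff 4 Lc)) Lc m (blk Lc z) (β, x) (κ', u') (κ, (Lc : ℤ) • Y + toSite v - unitVec κ))
            - (1 / 2 : ℝ) * (vh2KerAt (toSite (ctrOff 4 Lc)) Lc m (blk Lc z) (β, x) (κ, (Lc : ℤ) • Y + toSite v) (κ', u')
              + vh2KerAt (toSite (ctrOff 4 Lc)) Lc m (blk Lc z) (β, x) (κ', u') (κ, (Lc : ℤ) • Y + toSite v)))
      else 0 := by
  rw [wardB_def]
  simp only [vh₂SAn1_inl_inr]
  split_ifs with hz
  · congr 1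
    refine Finset.sum_congr rfl fun v _ => Finset.sum_congr rfl fun κ _ => ?_
    ring
  · simp

omit [NeZero Lc] in
/-- [folklore] The left side is ANTI-TWIN (from `vh₂SAn1_antiTwin`). -/
theorem wardB_inr_inl (cB : ℝ) (Y : Fin (3 + 1) → ℤ) (κ' : Fin (3 + 1)) (u' x z : Fin (3 + 1) → ℤ) (m β : Fin (3 + 1)) :
    ((stepScale 3 Lc 0 * (Lc : ℝ) ^ (3 + 1))⁻¹ • ∑ v ∈ box (3 + 1) Lc,
        divV (fun κ u => cB • vh₂SAn1 Lc κ u κ' u') ((Lc : ℤ) • Y + toSite v)) x z (Sum.inr m) (Sum.inl β) =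
      -((stepScale 3 Lc 0 * (Lc : ℝ) ^ (3 + 1))⁻¹ • ∑ v ∈ box (3 + 1) Lc,
        divV (fun κ u => cB • vh₂SAn1 Lc κ u κ' u') ((Lc : ℤ) • Y + toSite v)) z x (Sum.inl β) (Sum.inr m) := by
  rw [wardB_def, wardB_def, ← mul_neg, ← Finset.sum_neg_distrib]
  congr 1
  refine Finset.sum_congr rfl fun v _ => ?_
  rw [← Finset.sum_neg_distrib]
  refine Finset.sum_congr rfl fun κ _ => ?_
  rw [vh₂SAn1_antiTwin, vh₂SAn1_antiTwin]
  ring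

omit [NeZero Lc] in
/-- [folklore] The left side vanishes on `(inl, inl)`. -/
theorem wardB_inl_inl (cB : ℝ) (Y : Fin (3 + 1) → ℤ) (κ' : Fin (3 + 1)) (u' x z : Fin (3 + 1) → ℤ) (β β' : Fin (3 + 1)) :
    ((stepScale 3 Lc 0 * (Lc : ℝ) ^ (3 + 1))⁻¹ • ∑ v ∈ box (3 + 1) Lc,
        divV (fun κ u => cB • vh₂SAn1 Lc κ u κ' u') ((Lc : ℤ) • Y + toSite v)) x z (Sum.inl β) (Sum.inl β') = 0 := by
  rw [wardB_def]; simp [vh₂SAn1_inl_inl]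

omit [NeZero Lc] in
/-- [folklore] The left side vanishes on `(inr, inr)`. -/
theorem wardB_inr_inr (cB : ℝ) (Y : Fin (3 + 1) → ℤ) (κ' : Fin (3 + 1)) (u' x z : Fin (3 + 1) → ℤ) (m m' : Fin (3 + 1)) :
    ((stepScale 3 Lc 0 * (Lc : ℝ) ^ (3 + 1))⁻¹ • ∑ v ∈ box (3 + 1) Lc,
        divV (fun κ u => cB • vh₂SAn1 Lc κ u κ' u') ((Lc : ℤ) • Y + toSite v)) x z (Sum.inr m) (Sum.inr m') = 0 := by
  rw [wardB_def]; simp [vh₂SAn1_inr_inr]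

omit [NeZero Lc] in
/-- [folklore] The datum entrywise: `cVH · vhSAt … x z a b · (D(z,b) − D(x,a))`. -/
theorem datB_apply (cVH : ℝ) (Y : Fin (3 + 1) → ℤ) (κ' : Fin (3 + 1)) (u' x z : Fin (3 + 1) → ℤ) (a b : Fib 3) :
    (comp (cVH • vhSAt (toSite (ctrOff 4 Lc)) 3 Lc rfl κ' u')
        (diagK (((1 : ℝ) / 2) • ∑ v ∈ box (3 + 1) Lc, legInd (toSite (ctrOff 4 Lc)) ((Lc : ℤ) • Y + toSite v)))
      - comp (diagK (((1 : ℝ) / 2) • ∑ v ∈ box (3 + 1) Lc, legInd (toSite (ctrOff 4 Lc)) ((Lc : ℤ) • Y + toSite v)))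
        (cVH • vhSAt (toSite (ctrOff 4 Lc)) 3 Lc rfl κ' u')) x z a b =
      cVH * vhSAt (toSite (ctrOff 4 Lc)) 3 Lc rfl κ' u' x z a b *
        ((((1 : ℝ) / 2) • ∑ v ∈ box (3 + 1) Lc, legInd (toSite (ctrOff 4 Lc)) ((Lc : ℤ) • Y + toSite v)) z b
          - (((1 : ℝ) / 2) • ∑ v ∈ box (3 + 1) Lc, legInd (toSite (ctrOff 4 Lc)) ((Lc : ℤ) • Y + toSite v)) x a) := by
  simp only [Pi.sub_apply, comp_diagK_right, comp_diagK_left, Pi.smul_apply, smul_eq_mul]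
  ring

omit [NeZero Lc] in
/-- [folklore] **THE DATUM OF (W-B₀), `(inl, inr)` ENTRIES**: `cVH·m_{(m, blk z)}(f,h)·(D(z, inr) − D(x, inl))` on `off z = 0`, `0` off it, with
`D(z, inr m) = ½Σ_v[z + ρ_c = s_v]`, `D(x, inl β) = ½Σ_v[x = s_v]`. -/
theorem datB_inl_inr (cVH : ℝ) (Y : Fin (3 + 1) → ℤ) (κ' : Fin (3 + 1)) (u' x z : Fin (3 + 1) → ℤ) (β m : Fin (3 + 1)) :
    (comp (cVH • vhSAt (toSite (ctrOff 4 Lc)) 3 Lc rfl κ' u')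
        (diagK (((1 : ℝ) / 2) • ∑ v ∈ box (3 + 1) Lc, legInd (toSite (ctrOff 4 Lc)) ((Lc : ℤ) • Y + toSite v)))
      - comp (diagK (((1 : ℝ) / 2) • ∑ v ∈ box (3 + 1) Lc, legInd (toSite (ctrOff 4 Lc)) ((Lc : ℤ) • Y + toSite v)))
        (cVH • vhSAt (toSite (ctrOff 4 Lc)) 3 Lc rfl κ' u')) x z (Sum.inl β) (Sum.inr m) =
      if off Lc z = 0 then
        cVH * vhKerAt (toSite (ctrOff 4 Lc)) Lc m (blk Lc z) (β, x) (κ', u') *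
          ((1 / 2 : ℝ) * (∑ v ∈ box (3 + 1) Lc, (if z + toSite (ctrOff 4 Lc) = (Lc : ℤ) • Y + toSite v then (1 : ℝ) else 0))
            - (1 / 2 : ℝ) * (∑ v ∈ box (3 + 1) Lc, (if x = (Lc : ℤ) • Y + toSite v then (1 : ℝ) else 0)))
      else 0 := by
  rw [datB_apply]
  simp only [Pi.smul_apply, Finset.sum_apply, smul_eq_mul, legInd_inl, legInd_inr, vhSAt, packVH_inl_inr]
  split_ifs <;> ring

omit [NeZero Lc] in
/-- [folklore] The datum is ANTI-TWIN (from `vhSAt_symm`). -/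
theorem datB_inr_inl (cVH : ℝ) (Y : Fin (3 + 1) → ℤ) (κ' : Fin (3 + 1)) (u' x z : Fin (3 + 1) → ℤ) (m β : Fin (3 + 1)) :
    (comp (cVH • vhSAt (toSite (ctrOff 4 Lc)) 3 Lc rfl κ' u')
        (diagK (((1 : ℝ) / 2) • ∑ v ∈ box (3 + 1) Lc, legInd (toSite (ctrOff 4 Lc)) ((Lc : ℤ) • Y + toSite v)))
      - comp (diagK (((1 : ℝ) / 2) • ∑ v ∈ box (3 + 1) Lc, legInd (toSite (ctrOff 4 Lc)) ((Lc : ℤ) • Y + toSite v)))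
        (cVH • vhSAt (toSite (ctrOff 4 Lc)) 3 Lc rfl κ' u')) x z (Sum.inr m) (Sum.inl β) =
      -(comp (cVH • vhSAt (toSite (ctrOff 4 Lc)) 3 Lc rfl κ' u')
        (diagK (((1 : ℝ) / 2) • ∑ v ∈ box (3 + 1) Lc, legInd (toSite (ctrOff 4 Lc)) ((Lc : ℤ) • Y + toSite v)))
      - comp (diagK (((1 : ℝ) / 2) • ∑ v ∈ box (3 + 1) Lc, legInd (toSite (ctrOff 4 Lc)) ((Lc : ℤ) • Y + toSite v)))
        (cVH • vhSAt (toSite (ctrOff 4 Lc)) 3 Lc rfl κ' u')) z x (Sum.inl β) (Sum.inr m) := by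
  rw [datB_apply, datB_apply, vhSAt_symm (toSite (ctrOff 4 Lc)) Lc κ' u' x z (Sum.inr m) (Sum.inl β)]
  ring

omit [NeZero Lc] in
/-- [folklore] The datum vanishes on `(inl, inl)`. -/
theorem datB_inl_inl (cVH : ℝ) (Y : Fin (3 + 1) → ℤ) (κ' : Fin (3 + 1)) (u' x z : Fin (3 + 1) → ℤ) (β β' : Fin (3 + 1)) :
    (comp (cVH • vhSAt (toSite (ctrOff 4 Lc)) 3 Lc rfl κ' u')
        (diagK (((1 : ℝ) / 2) • ∑ v ∈ box (3 + 1) Lc, legInd (toSite (ctrOff 4 Lc)) ((Lc : ℤ) • Y + toSite v)))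
      - comp (diagK (((1 : ℝ) / 2) • ∑ v ∈ box (3 + 1) Lc, legInd (toSite (ctrOff 4 Lc)) ((Lc : ℤ) • Y + toSite v)))
        (cVH • vhSAt (toSite (ctrOff 4 Lc)) 3 Lc rfl κ' u')) x z (Sum.inl β) (Sum.inl β') = 0 := by
  rw [datB_apply]; simp [vhSAt, packVH_inl_inl]

omit [NeZero Lc] in
/-- [folklore] The datum vanishes on `(inr, inr)`. -/
theorem datB_inr_inr (cVH : ℝ) (Y : Fin (3 + 1) → ℤ) (κ' : Fin (3 + 1)) (u' x z : Fin (3 + 1) → ℤ) (m m' : Fin (3 + 1)) :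
    (comp (cVH • vhSAt (toSite (ctrOff 4 Lc)) 3 Lc rfl κ' u')
        (diagK (((1 : ℝ) / 2) • ∑ v ∈ box (3 + 1) Lc, legInd (toSite (ctrOff 4 Lc)) ((Lc : ℤ) • Y + toSite v)))
      - comp (diagK (((1 : ℝ) / 2) • ∑ v ∈ box (3 + 1) Lc, legInd (toSite (ctrOff 4 Lc)) ((Lc : ℤ) • Y + toSite v)))
        (cVH • vhSAt (toSite (ctrOff 4 Lc)) 3 Lc rfl κ' u')) x z (Sum.inr m) (Sum.inr m') = 0 := by
  rw [datB_apply]; simp [vhSAt, packVH_inr_inr]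

/-! ## §2 The bond-level border Ward law and the two exact letters -/

omit [NeZero Lc] in
/-- [folklore] **(WB-bond) ⟹ (W-B₀) AT `vh₂SAn1`** — the binder `hBord0[vh₂S := vh₂SAn1 Lc, r := ctrOff]` of `RowD1JointEnd.symmetries_JsRowD1_of_letters`
(any weight `cB`).  On `(inl, inr)` the law is the entry (§1); `(inr, inl)` = minus the transpose on both sides; `(inl,inl)`∕`(inr,inr)` vanish. -/
theorem wardBorder_of_bondLaw (hLc : 1 ≤ Lc) (cB : ℝ)
    (hWB : ∀ (Y yb : Fin (3 + 1) → ℤ) (m : Fin (3 + 1)) (κ' : Fin (3 + 1)) (u' : Fin (3 + 1) → ℤ) (β : Fin (3 + 1)) (x : Fin (3 + 1) → ℤ),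
      ((Lc : ℝ) ^ (3 + 1))⁻¹ * ∑ v ∈ box (3 + 1) Lc, ∑ κ : Fin (3 + 1),
          cB * ((1 / 2 : ℝ) * (vh2KerAt (toSite (ctrOff 4 Lc)) Lc m yb (β, x) (κ, (Lc : ℤ) • Y + toSite v - unitVec κ) (κ', u')
              + vh2KerAt (toSite (ctrOff 4 Lc)) Lc m yb (β, x) (κ', u') (κ, (Lc : ℤ) • Y + toSite v - unitVec κ))
            - (1 / 2 : ℝ) * (vh2KerAt (toSite (ctrOff 4 Lc)) Lc m yb (β, x) (κ, (Lc : ℤ) • Y + toSite v) (κ', u')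
              + vh2KerAt (toSite (ctrOff 4 Lc)) Lc m yb (β, x) (κ', u') (κ, (Lc : ℤ) • Y + toSite v))) =
        (-((Lc : ℝ) ^ (3 + 1) * (1 / 2) * (Lc : ℝ) ^ (3 + 1))) * vhKerAt (toSite (ctrOff 4 Lc)) Lc m yb (β, x) (κ', u') *
          ((1 / 2 : ℝ) * (∑ v ∈ box (3 + 1) Lc, (if (Lc : ℤ) • yb + toSite (ctrOff 4 Lc) = (Lc : ℤ) • Y + toSite v then (1 : ℝ) else 0))
            - (1 / 2 : ℝ) * (∑ v ∈ box (3 + 1) Lc, (if x = (Lc : ℤ) • Y + toSite v then (1 : ℝ) else 0)))) :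
    ∀ (Y : Fin (3 + 1) → ℤ) (κ' : Fin (3 + 1)) (u' : Fin (3 + 1) → ℤ),
      (stepScale 3 Lc 0 * (Lc : ℝ) ^ (3 + 1))⁻¹ • ∑ v ∈ box (3 + 1) Lc, divV (fun κ u => cB • vh₂SAn1 Lc κ u κ' u') ((Lc : ℤ) • Y + toSite v) =
        comp ((-((Lc : ℝ) ^ (3 + 1) * (1 / 2) * (Lc : ℝ) ^ (3 + 1))) • vhSAt (toSite (ctrOff 4 Lc)) 3 Lc rfl κ' u')
            (diagK (((1 : ℝ) / 2) • ∑ v ∈ box (3 + 1) Lc, legInd (toSite (ctrOff 4 Lc)) ((Lc : ℤ) • Y + toSite v)))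
          - comp (diagK (((1 : ℝ) / 2) • ∑ v ∈ box (3 + 1) Lc, legInd (toSite (ctrOff 4 Lc)) ((Lc : ℤ) • Y + toSite v)))
            ((-((Lc : ℝ) ^ (3 + 1) * (1 / 2) * (Lc : ℝ) ^ (3 + 1))) • vhSAt (toSite (ctrOff 4 Lc)) 3 Lc rfl κ' u') := by
  intro Y κ' u'
  -- the `(inl, inr)` block, every `x z`
  have key : ∀ (x z : Fin (3 + 1) → ℤ) (β m : Fin (3 + 1)),
      ((stepScale 3 Lc 0 * (Lc : ℝ) ^ (3 + 1))⁻¹ • ∑ v ∈ box (3 + 1) Lc,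
          divV (fun κ u => cB • vh₂SAn1 Lc κ u κ' u') ((Lc : ℤ) • Y + toSite v)) x z (Sum.inl β) (Sum.inr m) =
        (comp ((-((Lc : ℝ) ^ (3 + 1) * (1 / 2) * (Lc : ℝ) ^ (3 + 1))) • vhSAt (toSite (ctrOff 4 Lc)) 3 Lc rfl κ' u')
            (diagK (((1 : ℝ) / 2) • ∑ v ∈ box (3 + 1) Lc, legInd (toSite (ctrOff 4 Lc)) ((Lc : ℤ) • Y + toSite v)))
          - comp (diagK (((1 : ℝ) / 2) • ∑ v ∈ box (3 + 1) Lc, legInd (toSite (ctrOff 4 Lc)) ((Lc : ℤ) • Y + toSite v)))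
            ((-((Lc : ℝ) ^ (3 + 1) * (1 / 2) * (Lc : ℝ) ^ (3 + 1))) • vhSAt (toSite (ctrOff 4 Lc)) 3 Lc rfl κ' u')) x z (Sum.inl β) (Sum.inr m) := by
    intro x z β m
    rw [wardB_inl_inr, datB_inl_inr]
    by_cases hz : off Lc z = 0
    · rw [if_pos hz, if_pos hz]
      have ez : z = (Lc : ℤ) • blk Lc z := eq_smul_blk_of_off_eq_zero hLc hz
      have h := hWB Y (blk Lc z) m κ' u' β x
      rw [← ez] at h
      exact h
    · rw [if_neg hz, if_neg hz]
  funext x z a b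
  rcases a with β | m <;> rcases b with β' | m'
  · rw [wardB_inl_inl, datB_inl_inl]
  · exact key x z β m'
  · rw [wardB_inr_inl, datB_inr_inl, key z x β' m]
  · rw [wardB_inr_inr, datB_inr_inr]

omit [NeZero Lc] in
/-- [folklore] **(WB-bond) ⟹ (W-B₀″) AT `vh₂SAn1`** — the binder `hBord0''`: the second-slot divergence is the first-slot one by `vh₂SAn1_swap`. -/
theorem wardBorder''_of_bondLaw (hLc : 1 ≤ Lc) (cB : ℝ)
    (hWB : ∀ (Y yb : Fin (3 + 1) → ℤ) (m : Fin (3 + 1)) (κ' : Fin (3 + 1)) (u' : Fin (3 + 1) → ℤ) (β : Fin (3 + 1)) (x : Fin (3 + 1) → ℤ),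
      ((Lc : ℝ) ^ (3 + 1))⁻¹ * ∑ v ∈ box (3 + 1) Lc, ∑ κ : Fin (3 + 1),
          cB * ((1 / 2 : ℝ) * (vh2KerAt (toSite (ctrOff 4 Lc)) Lc m yb (β, x) (κ, (Lc : ℤ) • Y + toSite v - unitVec κ) (κ', u')
              + vh2KerAt (toSite (ctrOff 4 Lc)) Lc m yb (β, x) (κ', u') (κ, (Lc : ℤ) • Y + toSite v - unitVec κ))
            - (1 / 2 : ℝ) * (vh2KerAt (toSite (ctrOff 4 Lc)) Lc m yb (β, x) (κ, (Lc : ℤ) • Y + toSite v) (κ', u')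
              + vh2KerAt (toSite (ctrOff 4 Lc)) Lc m yb (β, x) (κ', u') (κ, (Lc : ℤ) • Y + toSite v))) =
        (-((Lc : ℝ) ^ (3 + 1) * (1 / 2) * (Lc : ℝ) ^ (3 + 1))) * vhKerAt (toSite (ctrOff 4 Lc)) Lc m yb (β, x) (κ', u') *
          ((1 / 2 : ℝ) * (∑ v ∈ box (3 + 1) Lc, (if (Lc : ℤ) • yb + toSite (ctrOff 4 Lc) = (Lc : ℤ) • Y + toSite v then (1 : ℝ) else 0))
            - (1 / 2 : ℝ) * (∑ v ∈ box (3 + 1) Lc, (if x = (Lc : ℤ) • Y + toSite v then (1 : ℝ) else 0)))) :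
    ∀ (Y : Fin (3 + 1) → ℤ) (κ : Fin (3 + 1)) (u : Fin (3 + 1) → ℤ),
      (stepScale 3 Lc 0 * (Lc : ℝ) ^ (3 + 1))⁻¹ • ∑ v ∈ box (3 + 1) Lc, divV (fun κ' u' => cB • vh₂SAn1 Lc κ u κ' u') ((Lc : ℤ) • Y + toSite v) =
        comp ((-((Lc : ℝ) ^ (3 + 1) * (1 / 2) * (Lc : ℝ) ^ (3 + 1))) • vhSAt (toSite (ctrOff 4 Lc)) 3 Lc rfl κ u)
            (diagK (((1 : ℝ) / 2) • ∑ v ∈ box (3 + 1) Lc, legInd (toSite (ctrOff 4 Lc)) ((Lc : ℤ) • Y + toSite v)))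
          - comp (diagK (((1 : ℝ) / 2) • ∑ v ∈ box (3 + 1) Lc, legInd (toSite (ctrOff 4 Lc)) ((Lc : ℤ) • Y + toSite v)))
            ((-((Lc : ℝ) ^ (3 + 1) * (1 / 2) * (Lc : ℝ) ^ (3 + 1))) • vhSAt (toSite (ctrOff 4 Lc)) 3 Lc rfl κ u) := by
  intro Y κ u
  have e : (fun κ' u' => cB • vh₂SAn1 Lc κ u κ' u') = fun κ' u' => cB • vh₂SAn1 Lc κ' u' κ u := by
    funext κ' u'; rw [vh₂SAn1_swap]
  rw [e]
  exact wardBorder_of_bondLaw hLc cB hWB Y κ u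

/-! ## §3 The row's symmetry binders from hM, hInv and the two bond-level Ward laws -/

/-- [folklore] **hW ∧ hR FOR THE PINNED LITERAL `JsRowD1Pin` ⟸ hM ∧ hInv ∧ (WB-bond)[cB := −Lc¹²∕4] ∧ (WM-bond)[cΛ := 2∕Lc⁴]** — K-W1's
`symmetries_JsRowD1Pin_of_letters_bondWard` with `hBord0`∕`hBord0''` supplied by §2.  CONDITIONAL on the four displayed identities about an1's tables. -/
theorem symmetries_JsRowD1Pin_of_bondLaws (hLc : Odd Lc) {N : ℕ} (hN : 2 ≤ N)
    (γ : ℕ → ℝ) (hγ : ∀ j, γ j = -((Lc : ℝ) ^ 8 / 2) * wVH 3 Lc j / (stepScale 3 Lc j * (Lc : ℝ) ^ 4))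
    (hM : ∀ (α κ : Fin 4) (u : Fin 4 → ℤ) (ρ' : Fin 4) (w : Fin 4 → ℤ),
      mixFFAt (toSite (ctrOff 4 Lc)) Lc κ (bref α κ u) ρ' (bref α ρ' w) =
        (reflSign α κ * reflSign α ρ') • refK (Φ Lc α)
          (mixFFAt (toSite (ctrOff 4 Lc)) Lc κ u ρ' w
            + (2 : ℝ) • comp (diagK (ctGen 3 α Lc κ u)) (hessFFAt (toSite (ctrOff 4 Lc)) Lc ρ' w)
            + (2 * (if ρ' = α then linKerAt (toSite (ctrOff 4 Lc)) Lc ρ' w (κ, u) else 0)) • hessFFAt (toSite (ctrOff 4 Lc)) Lc ρ' w))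
    (hInv : ∀ (α κ : Fin 4) (u : Fin 4 → ℤ) (κ' : Fin 4) (u' x z : Fin 4 → ℤ) (β m : Fin 4),
      (actB Lc α ((-((Lc : ℝ) ^ 12 / 4)) • vh₂SAn1 Lc - Twall Lc (2 / (Lc : ℝ) ^ 4) γ)
        - ((-((Lc : ℝ) ^ 12 / 4)) • vh₂SAn1 Lc - Twall Lc (2 / (Lc : ℝ) ^ 4) γ)) κ u κ' u' x z (Sum.inl β) (Sum.inr m) = 0)
    (hWB : ∀ (Y yb : Fin (3 + 1) → ℤ) (m : Fin (3 + 1)) (κ' : Fin (3 + 1)) (u' : Fin (3 + 1) → ℤ) (β : Fin (3 + 1)) (x : Fin (3 + 1) → ℤ),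
      ((Lc : ℝ) ^ (3 + 1))⁻¹ * ∑ v ∈ box (3 + 1) Lc, ∑ κ : Fin (3 + 1),
          (-((Lc : ℝ) ^ 12 / 4)) * ((1 / 2 : ℝ) * (vh2KerAt (toSite (ctrOff 4 Lc)) Lc m yb (β, x) (κ, (Lc : ℤ) • Y + toSite v - unitVec κ) (κ', u')
              + vh2KerAt (toSite (ctrOff 4 Lc)) Lc m yb (β, x) (κ', u') (κ, (Lc : ℤ) • Y + toSite v - unitVec κ))
            - (1 / 2 : ℝ) * (vh2KerAt (toSite (ctrOff 4 Lc)) Lc m yb (β, x) (κ, (Lc : ℤ) • Y + toSite v) (κ', u')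
              + vh2KerAt (toSite (ctrOff 4 Lc)) Lc m yb (β, x) (κ', u') (κ, (Lc : ℤ) • Y + toSite v))) =
        (-((Lc : ℝ) ^ (3 + 1) * (1 / 2) * (Lc : ℝ) ^ (3 + 1))) * vhKerAt (toSite (ctrOff 4 Lc)) Lc m yb (β, x) (κ', u') *
          ((1 / 2 : ℝ) * (∑ v ∈ box (3 + 1) Lc, (if (Lc : ℤ) • yb + toSite (ctrOff 4 Lc) = (Lc : ℤ) • Y + toSite v then (1 : ℝ) else 0))
            - (1 / 2 : ℝ) * (∑ v ∈ box (3 + 1) Lc, (if x = (Lc : ℤ) • Y + toSite v then (1 : ℝ) else 0))))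
    (hWM : ∀ (y : Fin (3 + 1) → ℤ) (ρ' : Fin (3 + 1)) (w : Fin (3 + 1) → ℤ) (β : Fin (3 + 1)) (x : Fin (3 + 1) → ℤ) (β' : Fin (3 + 1))
      (x' : Fin (3 + 1) → ℤ),
      ((Lc : ℝ) ^ (3 + 1))⁻¹ * (∑ v ∈ box (3 + 1) Lc, ∑ κ : Fin (3 + 1),
          ((mixKerAt (toSite (ctrOff 4 Lc)) Lc ρ' w (κ, (Lc : ℤ) • y + toSite v - unitVec κ) (β, x) (β', x')
              - mixKerAt (toSite (ctrOff 4 Lc)) Lc ρ' w (κ, (Lc : ℤ) • y + toSite v) (β, x) (β', x'))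
            + (mixKerAt (toSite (ctrOff 4 Lc)) Lc ρ' w (κ, (Lc : ℤ) • y + toSite v - unitVec κ) (β', x') (β, x)
              - mixKerAt (toSite (ctrOff 4 Lc)) Lc ρ' w (κ, (Lc : ℤ) • y + toSite v) (β', x') (β, x)))) =
        2 * ((2 / (Lc : ℝ) ^ 4) * hessKerAt (toSite (ctrOff 4 Lc)) Lc ρ' w (β, x) (β', x') *
          ((1 / 2 : ℝ) * (∑ v ∈ box (3 + 1) Lc, (if x' = (Lc : ℤ) • y + toSite v then (1 : ℝ) else 0))
            - (1 / 2 : ℝ) * (∑ v ∈ box (3 + 1) Lc, (if x = (Lc : ℤ) • y + toSite v then (1 : ℝ) else 0))))) :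
    (∀ j : ℕ, WardTransversal (flipK (TbalOf Lc (JsRowD1Pin hLc N) j)))
      ∧ (∀ j : ℕ, AxisReflectionCovariant (flipK (TbalOf Lc (JsRowD1Pin hLc N) j))) :=
  symmetries_JsRowD1Pin_of_letters_bondWard hLc hN γ hγ hM hInv
    (wardBorder_of_bondLaw hLc.pos _ hWB) (wardBorder''_of_bondLaw hLc.pos _ hWB) hWM

end

end Summit.QuantumFields.BalabanUV.Beta.BorderWardPacking
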